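import Literature.Geometry.Symplectic.CompatibleAlmostComplexStructureExists
import Literature.Geometry.Symplectic.AlmostComplexTangentBundle
import Literature.Geometry.Lorentzian.PseudoRiemannianMetric
import HarnessLib

/-!
# The Riemannian metric `g_J(v, w) = ω(v, Jw)` of an `ω`-compatible almost complex structure

Topic `Literature/Geometry/Symplectic`. McDuff–Salamon, *Introduction to Symplectic Topology*
(3rd ed. 2017), §4.1, (4.1.3): for `J ∈ 𝒥(M, ω)` "the bilinear form `g_J(v, w) := ω(v, Jw)`
defines a Riemannian metric"; C. H. Taubes, *The Seiberg–Witten and Gromov invariants*,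
Math. Res. Lett. 2 (1995), §3, p. 227: "Note that the assignment of `(v, w)` in `TX` to `ω(v, Jw)`
defines a metric on `TX`. For such a metric, the form `ω` is self-dual" — the metric in which
the Seiberg–Witten equations of a symplectic `4`-manifold are written (§2, §5 Step 1: "Use a metric
on `X` where the symplectic form `ω` is self-dual with norm `√2`").

For a `C^∞` almost complex structure `J` (`AlmostComplexStructure.lean`) compatible with a smooth
`2`-form `s` (`J.IsCompatibleWith s`: `s(v, Jv) > 0` for `v ≠ 0`, `s(Jv, Jw) = s(v, w)`) on a
manifold modelled on a real inner-product space `E` (the setting of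
`CompatibleAlmostComplexStructureExists.lean`), this file CONSTRUCTS

* `J.compatibleBilin s x : T_x M →L[ℝ] T_x M →L[ℝ] ℝ`, `(v, w) ↦ s(v, Jw)`;
* `IsCompatibleWith.metric h hs : PseudoRiemannianMetric I ∞ E (TangentSpace I)` — **the metric
  `g_J`** as a `C^∞` (pseudo-)Riemannian metric of the tree (`Lorentzian/PseudoRiemannianMetric`,
  the type over which the `Spin^c` structures and Seiberg–Witten equations of
  `Literature/Geometry/GaugeTheory` are written), with `IsRiemannian` (positive definite);

and PROVES (0 named facts): the value formula; symmetry and positivity ((4.1.3)); `J` is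
`g_J`-orthogonal, `g_J(Jv, Jw) = g_J(v, w)`, and `g_J`-skew, `g_J(v, Jw) = -g_J(Jv, w)`;
`s(v, w) = g_J(Jv, w)`; and smoothness of `x ↦ g_J,x` as a section of `Hom(TM, Hom(TM, ℝ))`
(Mathlib's `contMDiffAt_hom_bundle`: in the trivialisation at `x₀`, `g_J` is the chart
representative of `s` (`formInCoord`, smooth by `contMDiffAt_formInCoord`) composed with the
in-coordinates expression of `J`, and `(B, T) ↦ (v ↦ B(v) ∘ T)` is smooth).

Not here: self-duality of `s` and `|s| = √2` for `g_J` in dimension `4` (frame computations of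
`Literature/Geometry/GaugeTheory`), the Levi-Civita connection of `g_J`.

## References

* D. McDuff, D. Salamon, *Introduction to Symplectic Topology*, 3rd ed., OUP (2017), §4.1
  (4.1.3). [McDuffSalamon2017]
* C. H. Taubes, *The Seiberg–Witten and Gromov invariants*, Math. Res. Lett. 2 (1995) 221–238,
  §3 (p. 227), §5 Step 1 (p. 233). [Taubes1995]
-/

noncomputable section

open scoped Manifold ContDiff Topology
open Set Function Filter Bundle Literature.Geometry.Kaehler
open Literature.Geometry.Lorentzian (PseudoRiemannianMetric)

namespace Literature.Geometry.Symplectic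

variable {E : Type*} [NormedAddCommGroup E] [InnerProductSpace ℝ E]
  {H : Type*} [TopologicalSpace H] {I : ModelWithCorners ℝ E H}
  {M : Type*} [TopologicalSpace M] [ChartedSpace H M] [IsManifold I ∞ M]

namespace AlmostComplexStructure

/-! ### The bilinear form `g_J(v, w) = s(v, Jw)` -/

/-- **The bilinear form `g_J,x(v, w) := s_x(v, J_x w)`** of an almost complex structure and a
`2`-form at a point (McDuff–Salamon 2017, (4.1.3); Taubes 1995, §3 p. 227).
[cite: McDuffSalamon2017, §4.1 (4.1.3)] -/
def compatibleBilin (J : AlmostComplexStructure I ∞ M) (s : MForm I M ℝ 2) (x : M) :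
    E →L[ℝ] E →L[ℝ] ℝ :=
  ((ContinuousLinearMap.compL ℝ E E ℝ).flip (J.Jm x)).comp (bilinOfAlt (formAt s x))

/-- `g_J(v, w) = s(v, Jw)`. [cite: McDuffSalamon2017, §4.1 (4.1.3)] -/
@[simp]
theorem compatibleBilin_apply (J : AlmostComplexStructure I ∞ M) (s : MForm I M ℝ 2)
    (x : M) (v w : E) : J.compatibleBilin s x v w = s x ![v, J x w] := by
  simp only [compatibleBilin, ContinuousLinearMap.comp_apply, ContinuousLinearMap.flip_apply,
    ContinuousLinearMap.compL_apply, bilinOfAlt_apply, formAt_apply, Jm_apply]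
  rfl

/-! ### Smoothness of `x ↦ g_J,x` -/

section Smooth

/-- `(B, T) ↦ (v ↦ B(v) ∘ T)`, i.e. `(B, T) ↦ ((v, w) ↦ B(v, Tw))`, is smooth (post-composition
`compL` is continuous linear in `T`, composition is bounded bilinear). [folklore] -/
theorem contDiff_compL_flip_comp :
    ContDiff ℝ ∞ fun p : (E →L[ℝ] E →L[ℝ] ℝ) × (E →L[ℝ] E) ↦
      ((ContinuousLinearMap.compL ℝ E E ℝ).flip p.2).comp p.1 :=
  (contDiff_const.clm_apply contDiff_snd).clm_comp contDiff_fst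

/-- **`x ↦ g_J,x` is smooth in coordinates**: in the trivialisation of `TM` at `x₀` the bilinear form
`g_J` is, on the chart domain, the chart representative of `s` composed with the in-coordinates
expression of `J`. [cite: McDuffSalamon2017, §4.1 (4.1.3)] -/
theorem contMDiffAt_metricInCoord_compatibleBilin (J : AlmostComplexStructure I ∞ M) {s : MForm I M ℝ 2}
    (hs : IsSmoothForm s) (x₀ : M) :
    ContMDiffAt I 𝓘(ℝ, E →L[ℝ] E →L[ℝ] ℝ) ∞ (metricInCoord I (fun x ↦ J.compatibleBilin s x) x₀) x₀ := by
  have hsource : (chartAt H x₀).source ∈ 𝓝 x₀ :=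
    (chartAt H x₀).open_source.mem_nhds (mem_chart_source H x₀)
  have hJc : ContMDiffAt I 𝓘(ℝ, E →L[ℝ] E) ∞ (fun x ↦ ContinuousLinearMap.inCoordinates E
      (TangentSpace I : M → Type _) E (TangentSpace I : M → Type _) x₀ x x₀ x (J x)) x₀ :=
    ((contMDiffAt_hom_bundle _).1 (J.contMDiff x₀)).2
  have h := contDiff_compL_flip_comp.comp_contMDiffAt ((contMDiffAt_formInCoord hs x₀).prodMk_space hJc)
  refine h.congr_of_eventuallyEq ?_
  filter_upwards [hsource] with x hx
  have hxb : x ∈ (trivializationAt E (TangentSpace I : M → Type _) x₀).baseSet := by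
    rwa [TangentBundle.trivializationAt_baseSet]
  ext v w
  rw [metricInCoord_apply hx]
  simp only [comp_apply, compatibleBilin_apply, ContinuousLinearMap.comp_apply,
    ContinuousLinearMap.flip_apply, ContinuousLinearMap.compL_apply, formInCoord_apply hx,
    formAt_apply, ContinuousLinearMap.inCoordinates_eq hxb hxb, ContinuousLinearEquiv.coe_coe,
    Trivialization.symmL_apply _ hxb, Trivialization.continuousLinearEquivAt_apply,
    Trivialization.continuousLinearEquivAt_symm_apply, Trivialization.symm_apply_apply_mk _ hxb]
  rfl

/-- **`x ↦ g_J,x` is a `C^∞` section of `Hom(TM, Hom(TM, ℝ))`.** [cite: McDuffSalamon2017, §4.1 (4.1.3)] -/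
theorem contMDiff_compatibleBilin (J : AlmostComplexStructure I ∞ M) {s : MForm I M ℝ 2}
    (hs : IsSmoothForm s) :
    ContMDiff I (I.prod 𝓘(ℝ, E →L[ℝ] E →L[ℝ] ℝ)) ∞
      (fun x : M ↦ TotalSpace.mk' (E →L[ℝ] E →L[ℝ] ℝ)
        (E := fun y : M ↦ TangentSpace I y →L[ℝ] TangentSpace I y →L[ℝ] ℝ) x (J.compatibleBilin s x)) := by
  intro x₀
  rw [contMDiffAt_hom_bundle]
  exact ⟨contMDiffAt_id, J.contMDiffAt_metricInCoord_compatibleBilin hs x₀⟩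

end Smooth

/-! ### The metric of a compatible pair -/

namespace IsCompatibleWith

variable {J : AlmostComplexStructure I ∞ M} {s : MForm I M ℝ 2}

/-- **The metric `g_J` of an `s`-compatible almost complex structure** (McDuff–Salamon 2017,
(4.1.3): "`J` is compatible with `ω` if and only if … `g_J(v, w) := ω(v, Jw)` defines a Riemannian
metric"; Taubes 1995, §3 p. 227), as a `C^∞` pseudo-Riemannian metric on `TM` in the sense of the
tree (symmetric, non-degenerate, smooth section); it is Riemannian (`isRiemannian_metric`).
[cite: McDuffSalamon2017, §4.1 (4.1.3)] [cite: Taubes1995, §3 (p. 227)] -/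
def metric (h : J.IsCompatibleWith s) (hs : IsSmoothForm s) :
    PseudoRiemannianMetric I ∞ E (TangentSpace I : M → Type _) where
  val x := J.compatibleBilin s x
  symm x v w := by
    change J.compatibleBilin s x v w = J.compatibleBilin s x w v
    rw [compatibleBilin_apply, compatibleBilin_apply]
    exact h.symm x v w
  nondegenerate x v hv := by
    by_contra hne
    have h0 : J.compatibleBilin s x v v = 0 := hv v
    rw [compatibleBilin_apply] at h0
    exact (h.isTamedBy x v hne).ne' h0
  contMDiff := J.contMDiff_compatibleBilin hs

/-- **`g_J(v, w) = s(v, Jw)`.** [cite: McDuffSalamon2017, §4.1 (4.1.3)] -/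
@[simp]
theorem metric_val_apply (h : J.IsCompatibleWith s) (hs : IsSmoothForm s) (x : M)
    (v w : TangentSpace I x) : (h.metric hs).val x v w = s x ![v, J x w] :=
  compatibleBilin_apply J s x v w

/-- **`g_J` is Riemannian** (positive definite): `g_J(v, v) = s(v, Jv) > 0` for `v ≠ 0`.
[cite: McDuffSalamon2017, §4.1 (4.1.3)] -/
theorem isRiemannian_metric (h : J.IsCompatibleWith s) (hs : IsSmoothForm s) :
    (h.metric hs).IsRiemannian := fun x v hv ↦ by
  rw [metric_val_apply]
  exact h.isTamedBy x v hv

/-- `g_J` is symmetric: `s(v, Jw) = s(w, Jv)`. [cite: McDuffSalamon2017, §4.1 (4.1.3)] -/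
theorem metric_val_comm (h : J.IsCompatibleWith s) (hs : IsSmoothForm s) (x : M)
    (v w : TangentSpace I x) : (h.metric hs).val x v w = (h.metric hs).val x w v :=
  (h.metric hs).symm x v w

/-- **`J` is `g_J`-orthogonal**: `g_J(Jv, Jw) = g_J(v, w)`. [cite: McDuffSalamon2017, §4.1 (4.1.2)] -/
theorem metric_val_map_map (h : J.IsCompatibleWith s) (hs : IsSmoothForm s) (x : M)
    (v w : TangentSpace I x) : (h.metric hs).val x (J x v) (J x w) = (h.metric hs).val x v w := by
  rw [metric_val_apply, metric_val_apply, h.map_map]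

/-- **`s(v, w) = g_J(Jv, w)`**: the form is recovered from the metric and `J`.
[cite: McDuffSalamon2017, §4.1 (4.1.3)] -/
theorem form_eq_metric_val_map (h : J.IsCompatibleWith s) (hs : IsSmoothForm s) (x : M)
    (v w : TangentSpace I x) : s x ![v, w] = (h.metric hs).val x (J x v) w := by
  rw [metric_val_apply, h.map_map]

/-- **`J` is `g_J`-skew**: `g_J(v, Jw) = -g_J(Jv, w)`. [cite: McDuffSalamon2017, §4.1 (4.1.2)] -/
theorem metric_val_map_right (h : J.IsCompatibleWith s) (hs : IsSmoothForm s) (x : M)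
    (v w : TangentSpace I x) : (h.metric hs).val x v (J x w) = -(h.metric hs).val x (J x v) w := by
  rw [← metric_val_map_map h hs x v (J x w), J.map_map, map_neg]

/-- `g_J(v, v) > 0` for `v ≠ 0`, restated on the values. [cite: McDuffSalamon2017, §4.1 (4.1.1)] -/
theorem metric_val_self_pos (h : J.IsCompatibleWith s) (hs : IsSmoothForm s) (x : M)
    {v : TangentSpace I x} (hv : v ≠ 0) : 0 < (h.metric hs).val x v v :=
  h.isRiemannian_metric hs x v hv

end IsCompatibleWith

end AlmostComplexStructure

end Literature.Geometry.Symplectic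

end
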